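import Summits.CriticalPhenomena.PercolationContinuityZ3.Theorems.PercNearOneGluingNoHeavyLowerTailBlockQ9AnchoredDecomposition
import Summits.CriticalPhenomena.PercolationContinuityZ3.Theorems.PercNearOneGluingNoHeavyLowerTailBlockQ9GroupMergeMedian
import HarnessLib

/-!
# `NoHeavyLowerTail` (stmt-CriticalPhenomena-4575) — the PATTERN-BOUND SOCKET for block Question 9, and the median pattern bound

Support file (hull-port prover `prim-hp-1` gen 14; `--supports stmt-CriticalPhenomena-4575`).  No definitions, no named facts,
no sorries.  Memo: `run/shared/lean/prim/prim-hp-1/HULLPORT-COUPLING.md` §53, `CONJECTURES-gen14.md`.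

Setting as `…BlockQ9AnchoredDecomposition.lean`: unglued ranking graph `w`, block `O` (glued weights `glue_O w`), relays `A`,
`a, b ∉ O`, a finite set `F` of dangerous boundary pairs (every other boundary pair has a port dominating `a` in `kill_O w`).
For a pattern `T ⊆ F` write `P_T := pinW (glue_O w) F T` (pairs of `T` surely open, of `F ∖ T` surely closed) and
`ZR T := μ_{P_T}(O ↔ b)`, `Za T := μ_{P_T}(a ↔ b)`; `cw T := Π_{f∈F} w^T(f)` is the probability of the pattern.  Then
`BQ`'s margin is `cw ∅ · (Thm 4 margin of w − F) + Σ_{T ≠ ∅} cw T · (ZR T − Za T)`.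

* `BlockQ9.blockQ9_of_patternBounds` — the SOCKET: any family of real lower bounds `L T ≤ ZR T − Za T` (non-empty `T`) with
  `Σ_{T ≠ ∅} cw T · L T ≥ 0` proves `BQ`.  (Trivial bookkeeping; it is the typed interface into which cellwise certificates —
  transfer, Lemma 5, the median bound, exact cells — plug.)
* `BlockQ9.glue_pair_eq` — for a two-element block `O = {u₁,u₂}` the block gluing is the one-pair update `[s(u₁,u₂) ↦ 1]`.
* `BlockQ9.pattern_median_two` — the MEDIAN PATTERN BOUND for a two-hub block `O = {u₁, u₂}`: with the UNGLUED pinned graph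
  `Q_T := pinW w F T` (= the split world of the pattern) and `hᵢ T := μ_{Q_T}(uᵢ ↔ b) − μ_{Q_T}(a ↔ b)`,
  `median(h₁ T, 0, h₂ T) = max (min h₁ h₂) (min 0 (max h₁ h₂)) ≤ ZR T − Za T` (`merge_adv_ge_median`).
* `BlockQ9.blockQ9_twoHub_of_medianCertificate` — consequence: for ANY set `M` of non-empty patterns,
  `0 ≤ Σ_{T ≠ ∅, T ∉ M} cw T (ZR T − Za T) + Σ_{T ∈ M} cw T · median(h₁ T, 0, h₂ T)` implies `BQ`.  With `M` = the patterns
  not containing the pair of a chosen port `v` this is the peel-then-median certificate PM-v (memo §53(e)); with `M` chosen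
  cellwise it is the socket of the cellwise certificates WG-V / WG-κ of memo §53 (PM-v itself is refuted there, §53(g)).
-/

namespace Summit.CriticalPhenomena.PercolationContinuityZ3.Theorems

open MeasureTheory Set
open Literature.Probability.LatticeModels
open Literature.Probability.Percolation

noncomputable section
open Classical

namespace BlockQ9

variable {n : ℕ}

/-- **The pattern-bound socket for block Question 9.**  In the setting of `blockQ9_of_anchoredDecomposition` (block `O`,
relays `A`, dangerous boundary pairs `F`, the other boundary pairs dominated in `kill_O w`), suppose real numbers `L T`
satisfy `L T ≤ μ_{P_T}(O ↔ b) − μ_{P_T}(a ↔ b)` for every non-empty pattern `T ⊆ F` (`P_T = pinW (glue_O w) F T`) and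
`0 ≤ Σ_{∅ ≠ T ⊆ F} (Π_{f∈F} w^T f) · L T`.  Then `μ_{glue_O w}(a ↔ b, O ↔ A) ≤ μ_{glue_O w}(O ↔ b)`.  Proof: expand both
sides over the patterns of `F`; the empty pattern is Theorem 4 for `w − F` (`blockThm4_witness`), on a non-empty pattern the
block is a.s. alive. [cite: KozmaNitzan2024, Thm. 4 (pp. 12–14), Question 9 (p. 36)] -/
theorem blockQ9_of_patternBounds (w : Sym2 (Fin n) → unitInterval) (O A : Finset (Fin n))
    (a b : Fin n) (hOA : Disjoint O A) (haO : a ∉ O) (hbO : b ∉ O)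
    (hiso : ∀ x ∈ O, ∀ y : Fin n, y ∉ O → y ∉ A → w s(x, y) = 0)
    (F : Finset (Sym2 (Fin n)))
    (hF : ∀ f ∈ F, ∃ p s₀ : Fin n, f = s(p, s₀) ∧ s₀ ∈ O ∧ p ∈ A ∧ p ∉ O)
    (hdom : ∀ v ∈ A, ∀ o ∈ O, w s(o, v) ≠ 0 → s(o, v) ∉ F →
      (prodBernoulli (fun e : Sym2 (Fin n) => if (∃ x ∈ e, x ∈ O) then 0 else w e)).real (openConn a b) ≤
        (prodBernoulli (fun e : Sym2 (Fin n) => if (∃ x ∈ e, x ∈ O) then 0 else w e)).real (openConn v b))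
    (L : Finset (Sym2 (Fin n)) → ℝ)
    (hL : ∀ T ∈ F.powerset, T.Nonempty →
      L T ≤ (prodBernoulli (pinW (fun e : Sym2 (Fin n) => if (∀ x ∈ e, x ∈ O) ∧ ¬ e.IsDiag then 1 else w e)
              (↑F : Set (Sym2 (Fin n))) (↑T : Set (Sym2 (Fin n))))).real (⋃ o ∈ O, openConn o b) -
            (prodBernoulli (pinW (fun e : Sym2 (Fin n) => if (∀ x ∈ e, x ∈ O) ∧ ¬ e.IsDiag then 1 else w e)
              (↑F : Set (Sym2 (Fin n))) (↑T : Set (Sym2 (Fin n))))).real (openConn a b))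
    (hsum : 0 ≤ ∑ T ∈ F.powerset.erase ∅, (∏ f ∈ F, (if f ∈ T then (w f : ℝ) else 1 - (w f : ℝ))) * L T) :
    (prodBernoulli (fun e : Sym2 (Fin n) => if (∀ x ∈ e, x ∈ O) ∧ ¬ e.IsDiag then 1 else w e)).real
        (openConn a b ∩ ⋃ o ∈ O, ⋃ x ∈ A, openConn o x) ≤
      (prodBernoulli (fun e : Sym2 (Fin n) => if (∀ x ∈ e, x ∈ O) ∧ ¬ e.IsDiag then 1 else w e)).real
        (⋃ o ∈ O, openConn o b) := by
  -- names
  obtain ⟨g, hg⟩ : ∃ g : Sym2 (Fin n) → unitInterval,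
      g = fun e : Sym2 (Fin n) => if (∀ x ∈ e, x ∈ O) ∧ ¬ e.IsDiag then (1 : unitInterval) else w e := ⟨_, rfl⟩
  rw [← hg] at hL ⊢
  obtain ⟨OA, hOAdef⟩ : ∃ S : Set (BondConfig (Fin n)), S = ⋃ o ∈ O, ⋃ x ∈ A, openConn o x := ⟨_, rfl⟩
  obtain ⟨Ob, hObdef⟩ : ∃ S : Set (BondConfig (Fin n)), S = ⋃ o ∈ O, openConn o b := ⟨_, rfl⟩
  rw [← hOAdef, ← hObdef]
  rw [← hObdef] at hL
  -- `F` is not internal and meets `O`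
  have hFnint : ∀ f ∈ F, ¬ ((∀ x ∈ f, x ∈ O) ∧ ¬ f.IsDiag) := by
    intro f hf h
    obtain ⟨q, t, rfl, -, -, hqO⟩ := hF f hf
    exact hqO (h.1 q (Sym2.mem_mk_left q t))
  have hFmeets : ∀ f ∈ F, ∃ x ∈ f, x ∈ O := by
    intro f hf
    obtain ⟨q, t, rfl, htO, -, -⟩ := hF f hf
    exact ⟨t, Sym2.mem_mk_right q t, htO⟩
  have hgF : ∀ f ∈ F, g f = w f := fun f hf => by rw [hg]; exact if_neg (hFnint f hf)
  have hcylg : ∀ T ∈ F.powerset, (∏ f ∈ F, (if f ∈ T then (g f : ℝ) else 1 - (g f : ℝ))) =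
      ∏ f ∈ F, (if f ∈ T then (w f : ℝ) else 1 - (w f : ℝ)) := by
    intro T _
    exact Finset.prod_congr rfl fun f hf => by rw [hgF f hf]
  -- pinned glued weights and pattern values
  set P : Finset (Sym2 (Fin n)) → Sym2 (Fin n) → unitInterval :=
    fun T => pinW g (↑F : Set (Sym2 (Fin n))) (↑T : Set (Sym2 (Fin n))) with hP
  set ZL : Finset (Sym2 (Fin n)) → ℝ := fun T => (prodBernoulli (P T)).real (openConn a b ∩ OA) with hZL
  set Za : Finset (Sym2 (Fin n)) → ℝ := fun T => (prodBernoulli (P T)).real (openConn a b) with hZa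
  set ZR : Finset (Sym2 (Fin n)) → ℝ := fun T => (prodBernoulli (P T)).real Ob with hZR
  set cw : Finset (Sym2 (Fin n)) → ℝ := fun T => ∏ f ∈ F, (if f ∈ T then (w f : ℝ) else 1 - (w f : ℝ)) with hcw
  have hcw0 : ∀ T, 0 ≤ cw T := fun T => Finset.prod_nonneg fun f _ => by
    split_ifs
    · exact (w f).2.1
    · linarith [(w f).2.2]
  have hL' : ∀ T ∈ F.powerset, T.Nonempty → L T ≤ ZR T - Za T := fun T hT hTne => hL T hT hTne
  -- expansions of the two sides over the patterns of `F`
  have hLexp : (prodBernoulli g).real (openConn a b ∩ OA) = ∑ T ∈ F.powerset, cw T * ZL T := by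
    rw [real_eq_sum_cyl_pinW g F]
    exact Finset.sum_congr rfl fun T hT => by rw [hcylg T hT]
  have hRexp : (prodBernoulli g).real Ob = ∑ T ∈ F.powerset, cw T * ZR T := by
    rw [real_eq_sum_cyl_pinW g F]
    exact Finset.sum_congr rfl fun T hT => by rw [hcylg T hT]
  -- on a non-empty pattern the block is a.s. alive: `ZL T = Za T`
  have hZLa : ∀ T ∈ F.powerset, T.Nonempty → ZL T = Za T := by
    intro T hT hTne
    obtain ⟨f, hfT⟩ := hTne
    have hfF : f ∈ F := Finset.mem_powerset.1 hT hfT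
    obtain ⟨q, t, rfl, htO, hqA, hqO⟩ := hF f hfF
    have hqt : q ≠ t := fun h => hqO (h ▸ htO)
    have hPf : P T s(q, t) = 1 := by
      simp only [hP]
      exact pinW_apply_of_mem_of_mem _ (by exact_mod_cast hfF) (by exact_mod_cast hfT)
    simp only [hZL, hZa]
    rw [hOAdef]
    exact real_inter_blockAlive_of_weight_one (P T) O A htO hqA hqt hPf _
  -- the all-closed pattern: Theorem 4 for `w` with `F` deleted
  have hbase : ZL ∅ ≤ ZR ∅ := by
    set w₀ : Sym2 (Fin n) → unitInterval := pinW w (↑F : Set (Sym2 (Fin n))) (↑(∅ : Finset (Sym2 (Fin n))))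
      with hw₀
    have hP0 : P ∅ = fun e : Sym2 (Fin n) => if (∀ x ∈ e, x ∈ O) ∧ ¬ e.IsDiag then (1 : unitInterval) else w₀ e := by
      simp only [hP]
      rw [hg, glue_pinW_comm w O F hFnint]
    have hw₀F : ∀ f ∈ F, w₀ f = 0 := fun f hf => by
      rw [hw₀]; exact pinW_apply_of_mem_of_not_mem _ (by exact_mod_cast hf) (by simp)
    have hw₀off : ∀ f, f ∉ F → w₀ f = w f := fun f hf => by
      rw [hw₀]; exact pinW_apply_of_not_mem _ _ (by simpa using hf)
    have hiso₀ : ∀ x ∈ O, ∀ y : Fin n, y ∉ O → y ∉ A → w₀ s(x, y) = 0 := by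
      intro x hx y hyO hyA
      by_cases hf : s(x, y) ∈ F
      · exact hw₀F _ hf
      · rw [hw₀off _ hf]; exact hiso x hx y hyO hyA
    have hkill : (fun e : Sym2 (Fin n) => if (∃ x ∈ e, x ∈ O) then (0 : unitInterval) else w₀ e) =
        fun e : Sym2 (Fin n) => if (∃ x ∈ e, x ∈ O) then (0 : unitInterval) else w e := by
      funext e
      by_cases he : ∃ x ∈ e, x ∈ O
      · rw [if_pos he, if_pos he]
      · rw [if_neg he, if_neg he]
        have heF : e ∉ F := fun heF => he (hFmeets e heF)
        exact hw₀off e heF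
    have hdom₀ : ∀ v ∈ A, (∃ o ∈ O, w₀ s(o, v) ≠ 0) →
        (prodBernoulli (fun e : Sym2 (Fin n) => if (∃ x ∈ e, x ∈ O) then 0 else w₀ e)).real (openConn a b) ≤
          (prodBernoulli (fun e : Sym2 (Fin n) => if (∃ x ∈ e, x ∈ O) then 0 else w₀ e)).real (openConn v b) := by
      intro v hv ⟨o, ho, hne⟩
      have hoF : s(o, v) ∉ F := fun hf => hne (hw₀F _ hf)
      rw [hw₀off _ hoF] at hne
      rw [hkill]
      exact hdom v hv o ho hne hoF
    have key := blockThm4_witness w₀ O A a b hOA haO hbO hiso₀ hdom₀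
    simp only [hZL, hZR]
    rw [hP0, hOAdef, hObdef]
    exact key
  -- assemble
  rw [hLexp, hRexp, ← sub_nonpos, ← Finset.sum_sub_distrib]
  have hsplit : ∑ T ∈ F.powerset, (cw T * ZL T - cw T * ZR T) =
      cw ∅ * (ZL ∅ - ZR ∅) + ∑ T ∈ F.powerset.erase ∅, cw T * (Za T - ZR T) := by
    rw [← Finset.add_sum_erase F.powerset _ (Finset.empty_mem_powerset F)]
    congr 1
    · ring
    · refine Finset.sum_congr rfl fun T hT => ?_
      have hTne : T.Nonempty := Finset.nonempty_iff_ne_empty.2 (Finset.ne_of_mem_erase hT)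
      rw [hZLa T (Finset.mem_of_mem_erase hT) hTne]
      ring
  rw [hsplit]
  have hfirst : cw ∅ * (ZL ∅ - ZR ∅) ≤ 0 :=
    mul_nonpos_of_nonneg_of_nonpos (hcw0 ∅) (by linarith [hbase])
  have hsecond : ∑ T ∈ F.powerset.erase ∅, cw T * (Za T - ZR T) ≤
      ∑ T ∈ F.powerset.erase ∅, cw T * (- L T) := by
    refine Finset.sum_le_sum fun T hT => ?_
    have hTne : T.Nonempty := Finset.nonempty_iff_ne_empty.2 (Finset.ne_of_mem_erase hT)
    have h1 := hL' T (Finset.mem_of_mem_erase hT) hTne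
    exact mul_le_mul_of_nonneg_left (by linarith) (hcw0 T)
  have hthird : ∑ T ∈ F.powerset.erase ∅, cw T * (- L T) = - ∑ T ∈ F.powerset.erase ∅, cw T * L T := by
    rw [← Finset.sum_neg_distrib]
    exact Finset.sum_congr rfl fun T _ => by ring
  rw [hthird] at hsecond
  have hsum' : 0 ≤ ∑ T ∈ F.powerset.erase ∅, cw T * L T := hsum
  linarith

/-- For a two-element block `O = {u₁, u₂}` the block gluing `glue_O u` is the one-pair update `u[s(u₁,u₂) ↦ 1]`. [folklore] -/
theorem glue_pair_eq (u : Sym2 (Fin n) → unitInterval) {u₁ u₂ : Fin n} (h12 : u₁ ≠ u₂) :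
    (fun e : Sym2 (Fin n) => if (∀ x ∈ e, x ∈ ({u₁, u₂} : Finset (Fin n))) ∧ ¬ e.IsDiag then (1 : unitInterval) else u e) =
      fun e : Sym2 (Fin n) => if e = s(u₁, u₂) then 1 else u e := by
  funext e
  by_cases he : e = s(u₁, u₂)
  · subst he
    have h : (∀ x ∈ s(u₁, u₂), x ∈ ({u₁, u₂} : Finset (Fin n))) ∧ ¬ (s(u₁, u₂)).IsDiag := by
      refine ⟨fun x hx => ?_, by rw [Sym2.mk_isDiag_iff]; exact h12⟩
      rcases Sym2.mem_iff.1 hx with rfl | rfl <;> simp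
    rw [if_pos h, if_pos rfl]
  · rw [if_neg he]
    rw [if_neg]
    rintro ⟨hall, hnd⟩
    apply he
    induction e using Sym2.ind with
    | h x y =>
      have hx := hall x (Sym2.mem_mk_left x y)
      have hy := hall y (Sym2.mem_mk_right x y)
      rw [Sym2.mk_isDiag_iff] at hnd
      simp only [Finset.mem_insert, Finset.mem_singleton] at hx hy
      rcases hx with rfl | rfl <;> rcases hy with rfl | rfl
      · exact absurd rfl hnd
      · rfl
      · exact Sym2.eq_swap
      · exact absurd rfl hnd

/-- **The median pattern bound for a two-hub block.**  `O = {u₁, u₂}`, `u₁ ≠ u₂`, a pattern `T` of a set `F` of boundary pairs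
of `O`; `Q_T := pinW w F T` is the UNGLUED pinned graph (the split world of the pattern: each hub attached exactly to its ports in
`T`), `hᵢ := μ_{Q_T}(uᵢ ↔ b) − μ_{Q_T}(a ↔ b)` the split-world advantage of hub `i` over the anchor.  Then in the GLUED pinned graph
`P_T = pinW (glue_O w) F T`:  `max (min h₁ h₂) (min 0 (max h₁ h₂)) ≤ μ_{P_T}(O ↔ b) − μ_{P_T}(a ↔ b)`.
(`glue_O` of a two-element block is the pair update, so this is `merge_adv_ge_median` in `Q_T`.)
[cite: KozmaNitzan2024, Lemma 3 (pp. 6–7), Lemma 5 (p. 13)] -/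
theorem pattern_median_two (w : Sym2 (Fin n) → unitInterval) {u₁ u₂ : Fin n} (h12 : u₁ ≠ u₂) (a b : Fin n)
    (F : Finset (Sym2 (Fin n))) (hFnint : ∀ f ∈ F, ¬ ((∀ x ∈ f, x ∈ ({u₁, u₂} : Finset (Fin n))) ∧ ¬ f.IsDiag))
    (T : Finset (Sym2 (Fin n))) :
    max (min ((prodBernoulli (pinW w (↑F : Set (Sym2 (Fin n))) ↑T)).real (openConn u₁ b) -
              (prodBernoulli (pinW w (↑F : Set (Sym2 (Fin n))) ↑T)).real (openConn a b))
             ((prodBernoulli (pinW w (↑F : Set (Sym2 (Fin n))) ↑T)).real (openConn u₂ b) -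
              (prodBernoulli (pinW w (↑F : Set (Sym2 (Fin n))) ↑T)).real (openConn a b)))
        (min 0 (max ((prodBernoulli (pinW w (↑F : Set (Sym2 (Fin n))) ↑T)).real (openConn u₁ b) -
              (prodBernoulli (pinW w (↑F : Set (Sym2 (Fin n))) ↑T)).real (openConn a b))
             ((prodBernoulli (pinW w (↑F : Set (Sym2 (Fin n))) ↑T)).real (openConn u₂ b) -
              (prodBernoulli (pinW w (↑F : Set (Sym2 (Fin n))) ↑T)).real (openConn a b)))) ≤
      (prodBernoulli (pinW (fun e : Sym2 (Fin n) => if (∀ x ∈ e, x ∈ ({u₁, u₂} : Finset (Fin n))) ∧ ¬ e.IsDiag then 1 else w e)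
          (↑F : Set (Sym2 (Fin n))) ↑T)).real (⋃ o ∈ ({u₁, u₂} : Finset (Fin n)), openConn o b) -
        (prodBernoulli (pinW (fun e : Sym2 (Fin n) => if (∀ x ∈ e, x ∈ ({u₁, u₂} : Finset (Fin n))) ∧ ¬ e.IsDiag then 1 else w e)
          (↑F : Set (Sym2 (Fin n))) ↑T)).real (openConn a b) := by
  set Q : Sym2 (Fin n) → unitInterval := pinW w (↑F : Set (Sym2 (Fin n))) ↑T with hQ
  have hP : pinW (fun e : Sym2 (Fin n) => if (∀ x ∈ e, x ∈ ({u₁, u₂} : Finset (Fin n))) ∧ ¬ e.IsDiag then 1 else w e)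
      (↑F : Set (Sym2 (Fin n))) ↑T = fun e : Sym2 (Fin n) => if e = s(u₁, u₂) then 1 else Q e := by
    rw [glue_pinW_comm w {u₁, u₂} F hFnint, glue_pair_eq Q h12]
  rw [hP]
  have key := merge_adv_ge_median Q h12 a b
  -- `μ'(u₁ ↔ b) ≤ μ'(O ↔ b)`
  have hmono : (prodBernoulli (fun e : Sym2 (Fin n) => if e = s(u₁, u₂) then 1 else Q e)).real (openConn u₁ b) ≤
      (prodBernoulli (fun e : Sym2 (Fin n) => if e = s(u₁, u₂) then 1 else Q e)).real
        (⋃ o ∈ ({u₁, u₂} : Finset (Fin n)), openConn o b) :=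
    measureReal_mono (fun ω hω => Set.mem_iUnion₂.2 ⟨u₁, by simp, hω⟩) (measure_ne_top _ _)
  linarith

/-- **Two-hub block Question 9 from a median certificate (socket of the cellwise certificates of memo §53).**  Two-hub block
`O = {u₁, u₂}` in the setting of `blockQ9_of_patternBounds`; `M` any set of patterns (the "median cells").  If
`0 ≤ Σ_{∅≠T⊆F, T∉M} cw T · (μ_{P_T}(O ↔ b) − μ_{P_T}(a ↔ b)) + Σ_{∅≠T⊆F, T∈M} cw T · median(h₁ T, 0, h₂ T)`
(`P_T` glued pinned, `hᵢ T` the split-world advantages of `pattern_median_two`, `cw T = Π_{f∈F} w^T f`), then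
`μ_{glue_O w}(a ↔ b, O ↔ A) ≤ μ_{glue_O w}(O ↔ b)`.  (`M` = the patterns on which the median is used; the other patterns enter exactly.)
[cite: KozmaNitzan2024, Question 9 (p. 36), Lemma 5 (p. 13)] -/
theorem blockQ9_twoHub_of_medianCertificate (w : Sym2 (Fin n) → unitInterval) {u₁ u₂ : Fin n} (h12 : u₁ ≠ u₂)
    (A : Finset (Fin n)) (a b : Fin n)
    (hOA : Disjoint ({u₁, u₂} : Finset (Fin n)) A) (haO : a ∉ ({u₁, u₂} : Finset (Fin n))) (hbO : b ∉ ({u₁, u₂} : Finset (Fin n)))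
    (hiso : ∀ x ∈ ({u₁, u₂} : Finset (Fin n)), ∀ y : Fin n, y ∉ ({u₁, u₂} : Finset (Fin n)) → y ∉ A → w s(x, y) = 0)
    (F : Finset (Sym2 (Fin n)))
    (hF : ∀ f ∈ F, ∃ p s₀ : Fin n, f = s(p, s₀) ∧ s₀ ∈ ({u₁, u₂} : Finset (Fin n)) ∧ p ∈ A ∧ p ∉ ({u₁, u₂} : Finset (Fin n)))
    (hdom : ∀ v ∈ A, ∀ o ∈ ({u₁, u₂} : Finset (Fin n)), w s(o, v) ≠ 0 → s(o, v) ∉ F →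
      (prodBernoulli (fun e : Sym2 (Fin n) => if (∃ x ∈ e, x ∈ ({u₁, u₂} : Finset (Fin n))) then 0 else w e)).real (openConn a b) ≤
        (prodBernoulli (fun e : Sym2 (Fin n) => if (∃ x ∈ e, x ∈ ({u₁, u₂} : Finset (Fin n))) then 0 else w e)).real (openConn v b))
    (M : Finset (Finset (Sym2 (Fin n))))
    (hsum : 0 ≤
      ∑ T ∈ (F.powerset.erase ∅).filter (fun T => T ∉ M), (∏ f ∈ F, (if f ∈ T then (w f : ℝ) else 1 - (w f : ℝ))) *
          ((prodBernoulli (pinW (fun e : Sym2 (Fin n) => if (∀ x ∈ e, x ∈ ({u₁, u₂} : Finset (Fin n))) ∧ ¬ e.IsDiag then 1 else w e)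
              (↑F : Set (Sym2 (Fin n))) ↑T)).real (⋃ o ∈ ({u₁, u₂} : Finset (Fin n)), openConn o b) -
           (prodBernoulli (pinW (fun e : Sym2 (Fin n) => if (∀ x ∈ e, x ∈ ({u₁, u₂} : Finset (Fin n))) ∧ ¬ e.IsDiag then 1 else w e)
              (↑F : Set (Sym2 (Fin n))) ↑T)).real (openConn a b)) +
      ∑ T ∈ (F.powerset.erase ∅).filter (fun T => T ∈ M), (∏ f ∈ F, (if f ∈ T then (w f : ℝ) else 1 - (w f : ℝ))) *
          max (min ((prodBernoulli (pinW w (↑F : Set (Sym2 (Fin n))) ↑T)).real (openConn u₁ b) -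
                    (prodBernoulli (pinW w (↑F : Set (Sym2 (Fin n))) ↑T)).real (openConn a b))
                   ((prodBernoulli (pinW w (↑F : Set (Sym2 (Fin n))) ↑T)).real (openConn u₂ b) -
                    (prodBernoulli (pinW w (↑F : Set (Sym2 (Fin n))) ↑T)).real (openConn a b)))
              (min 0 (max ((prodBernoulli (pinW w (↑F : Set (Sym2 (Fin n))) ↑T)).real (openConn u₁ b) -
                    (prodBernoulli (pinW w (↑F : Set (Sym2 (Fin n))) ↑T)).real (openConn a b))
                   ((prodBernoulli (pinW w (↑F : Set (Sym2 (Fin n))) ↑T)).real (openConn u₂ b) -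
                    (prodBernoulli (pinW w (↑F : Set (Sym2 (Fin n))) ↑T)).real (openConn a b))))) :
    (prodBernoulli (fun e : Sym2 (Fin n) => if (∀ x ∈ e, x ∈ ({u₁, u₂} : Finset (Fin n))) ∧ ¬ e.IsDiag then 1 else w e)).real
        (openConn a b ∩ ⋃ o ∈ ({u₁, u₂} : Finset (Fin n)), ⋃ x ∈ A, openConn o x) ≤
      (prodBernoulli (fun e : Sym2 (Fin n) => if (∀ x ∈ e, x ∈ ({u₁, u₂} : Finset (Fin n))) ∧ ¬ e.IsDiag then 1 else w e)).real
        (⋃ o ∈ ({u₁, u₂} : Finset (Fin n)), openConn o b) := by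
  have hFnint : ∀ f ∈ F, ¬ ((∀ x ∈ f, x ∈ ({u₁, u₂} : Finset (Fin n))) ∧ ¬ f.IsDiag) := by
    intro f hf h
    obtain ⟨q, t, rfl, -, -, hqO⟩ := hF f hf
    exact hqO (h.1 q (Sym2.mem_mk_left q t))
  -- glued and split pattern values
  set ZD : Finset (Sym2 (Fin n)) → ℝ := fun T =>
    (prodBernoulli (pinW (fun e : Sym2 (Fin n) => if (∀ x ∈ e, x ∈ ({u₁, u₂} : Finset (Fin n))) ∧ ¬ e.IsDiag then 1 else w e)
        (↑F : Set (Sym2 (Fin n))) ↑T)).real (⋃ o ∈ ({u₁, u₂} : Finset (Fin n)), openConn o b) -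
    (prodBernoulli (pinW (fun e : Sym2 (Fin n) => if (∀ x ∈ e, x ∈ ({u₁, u₂} : Finset (Fin n))) ∧ ¬ e.IsDiag then 1 else w e)
        (↑F : Set (Sym2 (Fin n))) ↑T)).real (openConn a b) with hZD
  set med : Finset (Sym2 (Fin n)) → ℝ := fun T =>
    max (min ((prodBernoulli (pinW w (↑F : Set (Sym2 (Fin n))) ↑T)).real (openConn u₁ b) -
              (prodBernoulli (pinW w (↑F : Set (Sym2 (Fin n))) ↑T)).real (openConn a b))
             ((prodBernoulli (pinW w (↑F : Set (Sym2 (Fin n))) ↑T)).real (openConn u₂ b) -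
              (prodBernoulli (pinW w (↑F : Set (Sym2 (Fin n))) ↑T)).real (openConn a b)))
        (min 0 (max ((prodBernoulli (pinW w (↑F : Set (Sym2 (Fin n))) ↑T)).real (openConn u₁ b) -
              (prodBernoulli (pinW w (↑F : Set (Sym2 (Fin n))) ↑T)).real (openConn a b))
             ((prodBernoulli (pinW w (↑F : Set (Sym2 (Fin n))) ↑T)).real (openConn u₂ b) -
              (prodBernoulli (pinW w (↑F : Set (Sym2 (Fin n))) ↑T)).real (openConn a b)))) with hmed
  set cw : Finset (Sym2 (Fin n)) → ℝ := fun T => ∏ f ∈ F, (if f ∈ T then (w f : ℝ) else 1 - (w f : ℝ)) with hcw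
  -- the cellwise bound: exact off `M`, median on `M`
  set L : Finset (Sym2 (Fin n)) → ℝ := fun T => if T ∈ M then med T else ZD T with hLdef
  have hmedle : ∀ T, med T ≤ ZD T := fun T => by
    simp only [hmed, hZD]
    exact pattern_median_two w h12 a b F hFnint T
  refine blockQ9_of_patternBounds w {u₁, u₂} A a b hOA haO hbO hiso F hF hdom L ?_ ?_
  · intro T _ _
    show L T ≤ ZD T
    simp only [hLdef]
    split_ifs with hTM
    · exact hmedle T
    · exact le_rfl
  · -- split the sum along `M`
    have hsplit : ∑ T ∈ F.powerset.erase ∅, cw T * L T =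
        ∑ T ∈ (F.powerset.erase ∅).filter (fun T => T ∉ M), cw T * ZD T +
        ∑ T ∈ (F.powerset.erase ∅).filter (fun T => T ∈ M), cw T * med T := by
      rw [← Finset.sum_filter_add_sum_filter_not (F.powerset.erase ∅) (fun T => T ∈ M), add_comm]
      congr 1
      · refine Finset.sum_congr rfl fun T hT => ?_
        have hTM : T ∉ M := (Finset.mem_filter.1 hT).2
        simp only [hLdef, if_neg hTM]
      · refine Finset.sum_congr rfl fun T hT => ?_
        have hTM : T ∈ M := (Finset.mem_filter.1 hT).2
        simp only [hLdef, if_pos hTM]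
    show 0 ≤ ∑ T ∈ F.powerset.erase ∅, cw T * L T
    rw [hsplit]
    exact hsum

end BlockQ9

end

end Summit.CriticalPhenomena.PercolationContinuityZ3.Theorems
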